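import Mathlib
import Literature.NumberTheory.Transcendental.KZDominatedFamilyRelations
import Literature.NumberTheory.Transcendental.KZLogCalculusProofs
import Literature.NumberTheory.Transcendental.SemialgebraicMapsProofs
import Literature.NumberTheory.Transcendental.SemialgebraicLineDeriv
import Literature.NumberTheory.Transcendental.KZSemialgebraicComplex

/-!
# `TateLifting` (stmt-KontsevichZagierPeriods-9129), line `Sketch` — stub 49: RADIAL BAND

In the rotation sector of the line, the closed unit balls `B̄_n = {x ∈ ℝⁿ | ∑ xᵢ² ≤ 1}` of EVERY
dimension with radial polynomial integrands `P(|x|²)`, `P ∈ K[X]`, `K = ℚ̄ ∩ ℝ = algebraicClosure ℚ ℝ`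
(the real algebraic numbers; `(Polynomial.aeval t P : ℝ)` is evaluation through `K → ℝ`), are shown to
lie in `K₀[⟦π⟧]` by an induction `n ↦ n + 2`: the rotation engine turns `[B̄_{n+2}, P(|x|²)]` into its
MERIDIAN `m = [M, 2ρ · P(|v|² + ρ²)]`, `M = {(v, ρ) ∈ ℝⁿ⁺¹ | ρ > 0, |v|² + ρ² ≤ 1}` (base coordinates
`v = Fin.init p`, fibre coordinate `ρ = p (Fin.last n)`). This file proves `tateLifting_radialBand`,
the two remaining inputs of that induction:

* (a) STEP. `[m] − [B̄_n, Q(|v|²)] ∈ KZ.relations` for the polynomial `Q = P̃(1) − P̃ ∈ K[X]`, `P̃` a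
  `K`-primitive of `P` (`RadialBand.exists_derivative_eq`), the base representation being HONEST
  (domain literally the closed unit ball of `ℝⁿ`, integrand literally `v ↦ Q(|v|²)`, integrable as a
  continuous function on a subset of the compact cube `[−1, 1]ⁿ`). The BAND
  `B = {(v, ρ) | |v|² ≤ 1, 0 ≤ ρ ≤ √(1 − |v|²)} ⊇ M` carries the honest representation
  `[B, 2ρ · P(|v|² + ρ²)]`; `B ∖ M ⊆ {ρ = 0}` is null, so `[B, …] − [m]` is a relation (rule (1):
  `KZ.IntegralRep.of_sub_of_restrict_mem_relations`, then congruence of integrands on `M`,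
  `KZ.of_sub_of_mem_relations_of_eqOn`), and ONE Newton–Leibniz move (`KZ.newtonLeibnizRel`,
  rule (3)) along `ρ` with the polynomial primitive `F(v, ρ) = P̃(|v|² + ρ²)`
  (`∂F/∂ρ = 2ρ · P(|v|² + ρ²)`, `F(v, √(1 − |v|²)) − F(v, 0) = P̃(1) − P̃(|v|²) = Q(|v|²)`) gives
  `[B, …] − [B̄_n, Q(|v|²)] ∈ relations`.
* (b) BASE. In dimension one, `[B̄_1, P(x²)] = [[−1, 1], P(x²)]` differs by relations from a point
  representation (dimension `0`, domain `univ`): ONE Newton–Leibniz move over the point `ℝ⁰` with the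
  constant edges `−1 ≤ 1` and the polynomial primitive `G ∈ K[X]` of `P(X²)`, onto
  `[pt, G(1) − G(−1)]`.

All semialgebraicity statements are elementary: polynomials in the coordinates with real-algebraic
coefficients are `ℚ`-semialgebraic functions (`RadialBand.isSemialgebraicFunOn_aeval_comp`, algebraic
constants being `ℚ`-definable, `isSemialgebraicFunOn_const_of_isAlgebraic`), and so is
`v ↦ √(1 − |v|²)` (`IsSemialgebraicFunOn.fun_sqrt`).

References: M. Kontsevich, D. Zagier, *Periods* (2001), §1.1 and §1.2 rules (1), (3)
("Newton–Leibniz"); J. Bochnak, M. Coste, M.-F. Roy, *Real Algebraic Geometry* (1998), Prop. 2.2.6.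
-/

noncomputable section

open MeasureTheory Set
open Literature.NumberTheory.Transcendental
open Literature.ModelTheory.ExponentialFields (IsSemialgebraic isSemialgebraic_univ
  isSemialgebraic_setOf_eval_pos)

namespace Summit.KontsevichZagierPeriods.InverseLandau

namespace RadialBand

variable {d : ℕ}

/-- Every polynomial over a field of characteristic zero has a polynomial primitive:
`P = G′` with `G = Σₖ aₖ X^{k+1}/(k+1)`. [folklore] -/
theorem exists_derivative_eq {K : Type*} [Field K] [CharZero K] (P : Polynomial K) :
    ∃ G : Polynomial K, Polynomial.derivative G = P := by
  -- adapted from `polyUnc_exists_derivative_eq`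
  -- (Theorems/SymplecticScissorsVolumeFormPolyStackUnconditional.lean), `ℚ` replaced by `K`
  induction P using Polynomial.induction_on' with
  | add p q hp hq =>
    obtain ⟨Gp, hGp⟩ := hp
    obtain ⟨Gq, hGq⟩ := hq
    exact ⟨Gp + Gq, by rw [Polynomial.derivative_add, hGp, hGq]⟩
  | monomial n c =>
    refine ⟨Polynomial.monomial (n + 1) (c / ((n : K) + 1)), ?_⟩
    rw [Polynomial.derivative_monomial_succ, div_mul_cancel₀ c (Nat.cast_add_one_ne_zero n)]

/-- `y ↦ p(g y)` is `ℚ`-semialgebraic on `D ⊆ ℝᵈ` for `p ∈ K[X]` (`K = ℚ̄ ∩ ℝ`) and `g`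
`ℚ`-semialgebraic on `D`: induction on `p`, real-algebraic constants being `ℚ`-definable.
[cite: KontsevichZagier2001, §1.1] -/
theorem isSemialgebraicFunOn_aeval_comp {D : Set (Fin d → ℝ)} (hD : IsSemialgebraic ℚ D)
    {g : (Fin d → ℝ) → ℝ} (hg : IsSemialgebraicFunOn ℚ D g)
    (p : Polynomial (algebraicClosure ℚ ℝ)) :
    IsSemialgebraicFunOn ℚ D (fun y => (Polynomial.aeval (g y) p : ℝ)) := by
  -- adapted from `RatChart.rc_isSemialgebraicFunOn_aeval` (InverseLandauTateLiftingRatChart.lean,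
  -- dimension one), verbatim in dimension `d`
  induction p using Polynomial.induction_on' with
  | add p q hp hq =>
    refine (hp.fun_add hq).congr fun y _ => ?_
    simp
  | monomial n a =>
    refine ((isSemialgebraicFunOn_const_of_isAlgebraic hD (mem_algebraicClosure_iff.1 a.2)).fun_mul
      (hg.fun_pow n)).congr fun y _ => ?_
    simp [Polynomial.aeval_monomial, IntermediateField.algebraMap_apply]

/-- `v ↦ |v|² = ∑ vᵢ²` is a `ℚ`-semialgebraic function on every `ℚ`-semialgebraic `D ⊆ ℝᵈ` (a
polynomial in the coordinates). [cite: BochnakCosteRoy1998, Prop. 2.2.6] -/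
theorem isSemialgebraicFunOn_sumSq {D : Set (Fin d → ℝ)} (hD : IsSemialgebraic ℚ D) :
    IsSemialgebraicFunOn ℚ D (fun v => ∑ i, v i ^ 2) :=
  IsSemialgebraicFunOn.fun_finsetSum Finset.univ hD fun i _ =>
    (isSemialgebraicFunOn_apply hD i).fun_pow 2

/-- The closed unit ball `B̄_d = {∑ vᵢ² ≤ 1} ⊆ ℝᵈ` is `ℚ`-semialgebraic (the complement of one strict
polynomial inequality). [folklore] -/
theorem isSemialgebraic_closedBall (d : ℕ) :
    IsSemialgebraic ℚ {v : Fin d → ℝ | ∑ i, v i ^ 2 ≤ 1} := by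
  -- adapted from `KZ.BallPeeling.isSemialgebraic_ball` (the open ball)
  convert (isSemialgebraic_setOf_eval_pos (k := ℚ) (R := ℝ)
    (∑ i, (MvPolynomial.X i : MvPolynomial (Fin d) ℚ) ^ 2 - 1)).compl using 1
  ext v
  simp [sub_pos, not_lt]

/-- The closed unit ball `B̄_d` lies in the cube `[−1, 1]ᵈ`. [folklore] -/
theorem closedBall_subset_cube (d : ℕ) :
    {v : Fin d → ℝ | ∑ i, v i ^ 2 ≤ 1} ⊆ Set.pi univ fun _ => Icc (-1 : ℝ) 1 := by
  intro v hv
  have hv' : ∑ i, v i ^ 2 ≤ 1 := hv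
  simp only [mem_univ_pi, mem_Icc]
  intro i
  have hi : v i ^ 2 ≤ ∑ j, v j ^ 2 :=
    Finset.single_le_sum (fun j _ => sq_nonneg (v j)) (Finset.mem_univ i)
  exact abs_le.1 ((sq_le_one_iff_abs_le_one (v i)).1 (hi.trans hv'))

/-- A continuous function is absolutely integrable on the closed unit ball `B̄_d` (a subset of the
compact cube `[−1, 1]ᵈ`). [folklore] -/
theorem integrableOn_closedBall_of_continuous {f : (Fin d → ℝ) → ℝ} (hf : Continuous f) :
    IntegrableOn f {v : Fin d → ℝ | ∑ i, v i ^ 2 ≤ 1} :=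
  (hf.continuousOn.integrableOn_compact (isCompact_univ_pi fun _ => isCompact_Icc)).mono_set
    (closedBall_subset_cube d)

/-- For `Pt ∈ K[X]`, the polynomial `Q = Pt(1) − Pt ∈ K[X]` evaluates over `ℝ` to
`Q(s) = Pt(1) − Pt(s)`. [folklore] -/
theorem aeval_C_eval_one_sub (Pt : Polynomial (algebraicClosure ℚ ℝ)) (s : ℝ) :
    (Polynomial.aeval s (Polynomial.C (Polynomial.eval 1 Pt) - Pt) : ℝ) =
      Polynomial.aeval (1 : ℝ) Pt - Polynomial.aeval s Pt := by
  rw [map_sub, Polynomial.aeval_C, ← Polynomial.aeval_algebraMap_apply_eq_algebraMap_eval, map_one]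

end RadialBand

/-- **RADIAL BAND, STEP** (clause (a) of stub 49): the meridian
`m = [{(v, ρ) | ρ > 0, |v|² + ρ² ≤ 1}, 2ρ · P(|v|² + ρ²)]` of the closed unit ball of dimension
`n + 2` with the radial integrand `P(|x|²)` (`P ∈ K[X]`) differs by relations of the
Kontsevich–Zagier calculus from the HONEST radial representation `[B̄_n, Q(|v|²)]`,
`Q = P̃(1) − P̃` for a `K`-primitive `P̃` of `P`: the null piece `{ρ = 0}` of the band
`{|v|² ≤ 1, 0 ≤ ρ ≤ √(1 − |v|²)}` is a relation (rule (1)), and ONE Newton–Leibniz move along `ρ`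
(rule (3)) with the primitive `F(v, ρ) = P̃(|v|² + ρ²)` does the rest.
[cite: KontsevichZagier2001, §1.2 rule (3)] -/
theorem tateLifting_radialBand_step (n : ℕ) (P : Polynomial (algebraicClosure ℚ ℝ))
    (m : KZ.IntegralRep (n + 1))
    (hdom : m.domain = {p | 0 < p (Fin.last n) ∧
      ∑ i, (Fin.init p : Fin n → ℝ) i ^ 2 + p (Fin.last n) ^ 2 ≤ 1})
    (hint : Set.EqOn m.integrand (fun p => 2 * p (Fin.last n) *
      (Polynomial.aeval (∑ i, (Fin.init p : Fin n → ℝ) i ^ 2 + p (Fin.last n) ^ 2) P : ℝ))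
      m.domain) :
    ∃ (Q : Polynomial (algebraicClosure ℚ ℝ)) (b : KZ.IntegralRep n),
      b.domain = {v | ∑ i, v i ^ 2 ≤ 1} ∧
      (b.integrand = fun v => (Polynomial.aeval (∑ i, v i ^ 2) Q : ℝ)) ∧
      KZ.of m - KZ.of b ∈ KZ.relations := by
  -- a `K`-primitive `Pt` of `P` and the polynomial `Q = Pt(1) − Pt`
  obtain ⟨Pt, hPt⟩ := RadialBand.exists_derivative_eq P
  obtain ⟨Q, hQ_def⟩ : ∃ Q : Polynomial (algebraicClosure ℚ ℝ),
      Q = Polynomial.C (Polynomial.eval 1 Pt) - Pt := ⟨_, rfl⟩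
  have hQ : ∀ s : ℝ, (Polynomial.aeval s Q : ℝ) =
      Polynomial.aeval (1 : ℝ) Pt - Polynomial.aeval s Pt := fun s => by
    rw [hQ_def]
    exact RadialBand.aeval_C_eval_one_sub Pt s
  -- the base `τ = B̄_n`, the edges `α = 0 ≤ β = √(1 − |v|²)`
  set τ : Set (Fin n → ℝ) := {v | ∑ i, v i ^ 2 ≤ 1} with hτ_def
  have hτ : IsSemialgebraic ℚ τ := RadialBand.isSemialgebraic_closedBall n
  set α : (Fin n → ℝ) → ℝ := fun _ => 0 with hα_def
  set β : (Fin n → ℝ) → ℝ := fun v => Real.sqrt (1 - ∑ i, v i ^ 2) with hβ_def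
  have hα : IsSemialgebraicFunOn ℚ τ α :=
    isSemialgebraicFunOn_const_of_isAlgebraic hτ isAlgebraic_zero
  have hβ : IsSemialgebraicFunOn ℚ τ β :=
    ((isSemialgebraicFunOn_const_of_isAlgebraic hτ isAlgebraic_one).fun_sub
      (RadialBand.isSemialgebraicFunOn_sumSq hτ)).fun_sqrt
  have hαβ : ∀ v ∈ τ, α v ≤ β v := fun v _ => Real.sqrt_nonneg _
  -- the band `B ⊇ M`; `B ∖ M ⊆ {ρ = 0}` is null
  set B : Set (Fin (n + 1) → ℝ) := KZlog.band τ α β with hB_def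
  have hBsa : IsSemialgebraic ℚ B := KZlog.isSemialgebraic_band hα hβ
  have hMm : MeasurableSet m.domain := KZ.IntegralRep.measurableSet_domain_holds m
  have hMB : m.domain ⊆ B := by
    rw [hdom]
    rintro p ⟨hpos, hle⟩
    have hs : ∑ i, (Fin.init p : Fin n → ℝ) i ^ 2 ≤ 1 := by
      linarith [sq_nonneg (p (Fin.last n))]
    have h4 : p (Fin.last n) ^ 2 ≤ 1 - ∑ i, (Fin.init p : Fin n → ℝ) i ^ 2 := by linarith
    exact KZlog.mem_band.2 ⟨hs, hpos.le, (le_abs_self _).trans (Real.abs_le_sqrt h4)⟩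
  have hdiff : B \ m.domain ⊆ {p | p (Fin.last n) = 0} := by
    rintro p ⟨hpB, hpM⟩
    obtain ⟨h1, h2, h3⟩ := KZlog.mem_band.1 hpB
    have h1' : ∑ i, (Fin.init p : Fin n → ℝ) i ^ 2 ≤ 1 := h1
    have h2' : 0 ≤ p (Fin.last n) := h2
    have h3' : p (Fin.last n) ≤ Real.sqrt (1 - ∑ i, (Fin.init p : Fin n → ℝ) i ^ 2) := h3
    show p (Fin.last n) = 0
    by_contra hne
    have hpos : 0 < p (Fin.last n) := lt_of_le_of_ne h2' (Ne.symm hne)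
    have h4 : p (Fin.last n) ^ 2 ≤ 1 - ∑ i, (Fin.init p : Fin n → ℝ) i ^ 2 := by
      calc p (Fin.last n) ^ 2
          ≤ Real.sqrt (1 - ∑ i, (Fin.init p : Fin n → ℝ) i ^ 2) ^ 2 :=
            pow_le_pow_left₀ hpos.le h3' 2
        _ = 1 - ∑ i, (Fin.init p : Fin n → ℝ) i ^ 2 := Real.sq_sqrt (by linarith)
    apply hpM
    rw [hdom]
    exact ⟨hpos, by linarith⟩
  have hnull : volume (B \ m.domain) = 0 :=
    measure_mono_null hdiff (KZ.volume_setOf_last_eq_zero 0)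
  -- the honest band representation `mB = [B, 2ρ · P(|v|² + ρ²)]`
  set g : (Fin (n + 1) → ℝ) → ℝ := fun p => 2 * p (Fin.last n) *
      (Polynomial.aeval (∑ i, (Fin.init p : Fin n → ℝ) i ^ 2 + p (Fin.last n) ^ 2) P : ℝ) with hg_def
  have hρB : IsSemialgebraicFunOn ℚ B
      (fun p => ∑ i, (Fin.init p : Fin n → ℝ) i ^ 2 + p (Fin.last n) ^ 2) :=
    (IsSemialgebraicFunOn.fun_finsetSum Finset.univ hBsa fun i _ =>
      (isSemialgebraicFunOn_apply hBsa (Fin.castSucc i)).fun_pow 2).fun_add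
      ((isSemialgebraicFunOn_apply hBsa (Fin.last n)).fun_pow 2)
  have hgsa : IsSemialgebraicFunOn ℚ B g :=
    ((isSemialgebraicFunOn_const_ofNat hBsa 2).fun_mul
      (isSemialgebraicFunOn_apply hBsa (Fin.last n))).fun_mul
      (RadialBand.isSemialgebraicFunOn_aeval_comp hBsa hρB P)
  have hgint : IntegrableOn g B := by
    have h1 : IntegrableOn g m.domain := m.integrableOn.congr_fun hint hMm
    have h2 : IntegrableOn g (B \ m.domain) := by
      rw [IntegrableOn, Measure.restrict_eq_zero.2 hnull]
      exact integrable_zero_measure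
    rw [← Set.union_sdiff_cancel hMB]
    exact h1.union h2
  let mB : KZ.IntegralRep (n + 1) := ⟨B, g, hBsa, hgsa, hgint⟩
  -- `[mB] − [m] ∈ relations`: split off the null piece, then congruence on `M`
  have hrel1 : KZ.of mB - KZ.of m ∈ KZ.relations := by
    have h1 := KZ.IntegralRep.of_sub_of_restrict_mem_relations mB m.isSemialgebraic_domain hMB hnull
    have h2 : KZ.of (mB.restrict m.domain m.isSemialgebraic_domain hMB) - KZ.of m ∈ KZ.relations :=
      KZ.of_sub_of_mem_relations_of_eqOn (r := mB.restrict m.domain m.isSemialgebraic_domain hMB)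
        (r' := m) rfl fun p hp => (hint hp).symm
    have h := KZ.relations.add_mem h1 h2
    rwa [sub_add_sub_cancel] at h
  -- the honest base representation `b = [B̄_n, Q(|v|²)]`
  have hbsa : IsSemialgebraicFunOn ℚ τ (fun v => (Polynomial.aeval (∑ i, v i ^ 2) Q : ℝ)) :=
    RadialBand.isSemialgebraicFunOn_aeval_comp hτ (RadialBand.isSemialgebraicFunOn_sumSq hτ) Q
  have hbcont : Continuous (fun v : Fin n → ℝ => (Polynomial.aeval (∑ i, v i ^ 2) Q : ℝ)) := by
    fun_prop
  have hbint : IntegrableOn (fun v => (Polynomial.aeval (∑ i, v i ^ 2) Q : ℝ)) τ :=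
    RadialBand.integrableOn_closedBall_of_continuous hbcont
  let b : KZ.IntegralRep n := ⟨τ, fun v => (Polynomial.aeval (∑ i, v i ^ 2) Q : ℝ), hτ, hbsa, hbint⟩
  -- the primitive `F(v, ρ) = Pt(|v|² + ρ²)` and ONE Newton–Leibniz move: `[mB] − [b] ∈ relations`
  set F : (Fin (n + 1) → ℝ) → ℝ := fun p =>
    (Polynomial.aeval (∑ i, (Fin.init p : Fin n → ℝ) i ^ 2 + p (Fin.last n) ^ 2) Pt : ℝ) with hF_def
  have hF : IsSemialgebraicFunOn ℚ B F := RadialBand.isSemialgebraicFunOn_aeval_comp hBsa hρB Pt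
  have hrel2 : KZ.of mB - KZ.of b ∈ KZ.relations := by
    refine KZ.newtonLeibnizRel_subset_relations ⟨n, mB, b, α, β, F, hF, hα, hβ, hαβ, rfl,
      fun x _ => ?_, fun x _ t _ => ?_, fun x hx => ?_, rfl⟩
    · -- `t ↦ F (x, t) = Pt(|x|² + t²)` is continuous on the closed fibre
      simp only [hF_def, Fin.init_snoc, Fin.snoc_last]
      fun_prop
    · -- `∂/∂t F (x, t) = 2t · P(|x|² + t²) = mB.integrand (x, t)` on the open fibre
      show HasDerivAt (fun s : ℝ => F (Fin.snoc x s)) (g (Fin.snoc x t)) t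
      simp only [hF_def, hg_def, Fin.init_snoc, Fin.snoc_last]
      have hinner : HasDerivAt (fun s : ℝ => ∑ i, x i ^ 2 + s ^ 2) (2 * t) t := by
        simpa using (hasDerivAt_pow 2 t).const_add (∑ i, x i ^ 2)
      have h := (Polynomial.hasDerivAt_aeval Pt (∑ i, x i ^ 2 + t ^ 2)).comp t hinner
      rw [hPt] at h
      refine h.congr_deriv ?_
      ring
    · -- `b.integrand x = F (x, β x) − F (x, α x) = Pt(1) − Pt(|x|²)`
      have hx' : ∑ i, x i ^ 2 ≤ 1 := hx
      have h1x : 0 ≤ 1 - ∑ i, x i ^ 2 := by linarith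
      simp only [hF_def, hα_def, hβ_def, Fin.init_snoc, Fin.snoc_last]
      rw [Real.sq_sqrt h1x, add_sub_cancel, zero_pow two_ne_zero, add_zero]
      exact hQ _
  refine ⟨Q, b, rfl, rfl, ?_⟩
  have h := KZ.relations.sub_mem hrel2 hrel1
  rwa [sub_sub_sub_cancel_left] at h

/-- **RADIAL BAND, BASE** (clause (b) of stub 49): in dimension one,
`[B̄_1, P(x²)] = [[−1, 1], P(x²)]` (`P ∈ K[X]`) differs by relations of the Kontsevich–Zagier
calculus from a point representation (dimension `0`, domain `univ`): ONE Newton–Leibniz move over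
the point `ℝ⁰` (rule (3), constant edges `−1 ≤ 1`) with the polynomial primitive `G ∈ K[X]` of
`P(X²)`, onto `[pt, G(1) − G(−1)]`. [cite: KontsevichZagier2001, §1.2 rule (3)] -/
theorem tateLifting_radialBand_base (P : Polynomial (algebraicClosure ℚ ℝ)) (r : KZ.IntegralRep 1)
    (hdom : r.domain = {v | ∑ i, v i ^ 2 ≤ 1})
    (hint : Set.EqOn r.integrand (fun v => (Polynomial.aeval (∑ i, v i ^ 2) P : ℝ)) r.domain) :
    ∃ r₀ : KZ.IntegralRep 0, r₀.domain = Set.univ ∧ KZ.of r - KZ.of r₀ ∈ KZ.relations := by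
  -- a `K`-primitive `G` of `P(X²)`
  obtain ⟨G, hG⟩ := RadialBand.exists_derivative_eq (P.comp (Polynomial.X ^ 2))
  -- the point representation `r₀ = [pt, G(1) − G(−1)]`
  have h0 : IsSemialgebraic ℚ (Set.univ : Set (Fin 0 → ℝ)) := isSemialgebraic_univ
  have hcsa : IsSemialgebraicFunOn ℚ (Set.univ : Set (Fin 0 → ℝ))
      (fun _ => (Polynomial.aeval (1 : ℝ) G : ℝ) - Polynomial.aeval (-1 : ℝ) G) :=
    (RadialBand.isSemialgebraicFunOn_aeval_comp h0
      (isSemialgebraicFunOn_const_of_isAlgebraic h0 isAlgebraic_one) G).fun_sub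
      (RadialBand.isSemialgebraicFunOn_aeval_comp h0
        (isSemialgebraicFunOn_const_of_isAlgebraic h0 isAlgebraic_one.neg) G)
  haveI hfin : IsFiniteMeasure (volume : Measure (Fin 0 → ℝ)) := by
    rw [volume_pi, Measure.pi_of_empty]
    infer_instance
  have hcint : IntegrableOn (fun _ : Fin 0 → ℝ =>
      (Polynomial.aeval (1 : ℝ) G : ℝ) - Polynomial.aeval (-1 : ℝ) G) Set.univ :=
    (integrable_const _).integrableOn
  let r₀ : KZ.IntegralRep 0 := ⟨Set.univ,
    fun _ => (Polynomial.aeval (1 : ℝ) G : ℝ) - Polynomial.aeval (-1 : ℝ) G, h0, hcsa, hcint⟩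
  -- the interval `[−1, 1]` is the band over the point with the constant edges `−1 ≤ 1`
  have hband : r.domain = {z : Fin 1 → ℝ | Fin.init z ∈ (Set.univ : Set (Fin 0 → ℝ)) ∧
      (-1 : ℝ) ≤ z (Fin.last 0) ∧ z (Fin.last 0) ≤ 1} := by
    rw [hdom]
    ext z
    simp only [mem_setOf_eq, mem_univ, true_and, Fin.sum_univ_one]
    rw [show (Fin.last 0 : Fin 1) = 0 from rfl, sq_le_one_iff_abs_le_one, abs_le]
  refine ⟨r₀, rfl, KZ.newtonLeibnizRel_subset_relations ⟨0, r, r₀, fun _ => -1, fun _ => 1,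
    fun z => (Polynomial.aeval (z (Fin.last 0)) G : ℝ),
    RadialBand.isSemialgebraicFunOn_aeval_comp r.isSemialgebraic_domain
      (isSemialgebraicFunOn_apply r.isSemialgebraic_domain (Fin.last 0)) G,
    isSemialgebraicFunOn_const_of_isAlgebraic h0 isAlgebraic_one.neg,
    isSemialgebraicFunOn_const_of_isAlgebraic h0 isAlgebraic_one, fun _ _ => by norm_num, hband,
    fun x _ => ?_, fun x _ t ht => ?_, fun x _ => ?_, rfl⟩⟩
  · -- `t ↦ G(t)` is continuous
    simp only [Fin.snoc_last]
    fun_prop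
  · -- `d/dt G(t) = P(t²) = r.integrand (x, t)` on the open fibre
    -- over the point `ℝ⁰`, `Fin.snoc x s` is the constant tuple `s`
    have hsnoc : ∀ s : ℝ, (Fin.snoc x s : Fin 1 → ℝ) = fun _ => s :=
      fun s => funext fun i => by rw [Fin.eq_zero i]; rfl
    have ht' : t ∈ Ioo (-1 : ℝ) 1 := ht
    have hmem : (Fin.snoc x t : Fin 1 → ℝ) ∈ r.domain := by
      rw [hdom, hsnoc]
      simp only [mem_setOf_eq, Fin.sum_univ_one]
      nlinarith [ht'.1, ht'.2]
    rw [hint hmem]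
    simp only [hsnoc, Fin.sum_univ_one]
    have h := Polynomial.hasDerivAt_aeval G t
    rw [hG, Polynomial.aeval_comp, Polynomial.aeval_X_pow] at h
    exact h
  · -- `r₀.integrand x = G(1) − G(−1)`
    simp only [Fin.snoc_last]
    rfl

/-- **RADIAL BAND** (stub 49 `stub_radialBand` of the lead's skeleton, the registered statement
`TateLiftingSketch.RadialBand` unfolded). (a) STEP: the meridian of the closed unit ball of dimension
`n + 2` with the radial integrand `P(|x|²)` (`P ∈ K[X]`, `K = ℚ̄ ∩ ℝ`) is
`[{(v, ρ) | ρ > 0, |v|² + ρ² ≤ 1}, 2ρ · P(|v|² + ρ²)]`; ONE Newton–Leibniz move along `ρ` with the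
polynomial primitive `F(v, ρ) = P̃(|v|² + ρ²)` (`P̃′ = P`) over the closed unit ball of dimension `n`
(null piece `{ρ = 0}` first) turns it into the honest radial representation `[B̄_n, Q(|v|²)]`,
`Q = P̃(1) − P̃ ∈ K[X]`. (b) BASE: in dimension one, `[[−1, 1], P(x²)]` differs by relations from a
point (one Newton–Leibniz move over `ℝ⁰` with a polynomial primitive of `P(X²)`).
[cite: KontsevichZagier2001, §1.2 rule (3)] -/
theorem tateLifting_radialBand :
  (∀ (n : ℕ) (P : Polynomial (algebraicClosure ℚ ℝ)) (m : KZ.IntegralRep (n + 1)),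
    m.domain = {p | 0 < p (Fin.last n) ∧
      ∑ i, (Fin.init p : Fin n → ℝ) i ^ 2 + p (Fin.last n) ^ 2 ≤ 1} →
    Set.EqOn m.integrand (fun p => 2 * p (Fin.last n) *
      (Polynomial.aeval (∑ i, (Fin.init p : Fin n → ℝ) i ^ 2 + p (Fin.last n) ^ 2) P : ℝ)) m.domain →
    ∃ (Q : Polynomial (algebraicClosure ℚ ℝ)) (b : KZ.IntegralRep n),
      b.domain = {v | ∑ i, v i ^ 2 ≤ 1} ∧
      (b.integrand = fun v => (Polynomial.aeval (∑ i, v i ^ 2) Q : ℝ)) ∧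
      KZ.of m - KZ.of b ∈ KZ.relations) ∧
  (∀ (P : Polynomial (algebraicClosure ℚ ℝ)) (r : KZ.IntegralRep 1),
    r.domain = {v | ∑ i, v i ^ 2 ≤ 1} →
    Set.EqOn r.integrand (fun v => (Polynomial.aeval (∑ i, v i ^ 2) P : ℝ)) r.domain →
    ∃ r₀ : KZ.IntegralRep 0, r₀.domain = Set.univ ∧ KZ.of r - KZ.of r₀ ∈ KZ.relations) :=
  ⟨tateLifting_radialBand_step, tateLifting_radialBand_base⟩

end Summit.KontsevichZagierPeriods.InverseLandau

end
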